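import Summits.ValiantsHypothesis.ValiantsHypothesis.Theses.GrenetZeon
import Literature.Computability.AlgebraicComplexity.AlgDetRepr
import Literature.Computability.AlgebraicComplexity.MignonRessayreBound

/-!
# Skeleton line `vbp-slice-dealg` for the piece `PolySizeQPAlgebra` (stmt-ValiantsHypothesis-8064)
# of the decomposition `AlgDcQP ⇐ TransferToDc ∧ AbelianizationQP ∧ PolySizeQPAlgebra`

`PolySizeQPAlgebra`: for every `c`, for all large `n`, `per_n` has no `(m, s)`-representation with
`m ≤ n^c + c` (polynomial matrix size) and `s ≤ 2^((log₂ n + c)^c)` (quasi-polynomial commutative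
coefficient dimension).

Line: the piece is its `s = 1` SLICE (a classical milestone) plus the LIFT along the `s`-axis.
* `stub_vbpSlice` — `VNP ⊄ VBP` in dc form, for all large `n`: `dc(per_n) > n^c + c` eventually
  (Bürgisser 2000 Ch. 2; Malod–Portier 2008: `VBP` = polynomially bounded dc).  Strictly weaker than
  the summit as far as is known (`VBP ⊆ VP`), and the `s = 1` slice of the piece
  (`hasAlgDetRepr_one_iff`).
* `stub_dealgebraizePoly` — DE-ALGEBRAIZATION AT POLYNOMIAL COST IN THE POLYNOMIAL REGIME: for the
  permanent, quasi-polynomial-dimensional commuting coefficients on a polynomial-size matrix can be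
  removed at polynomial cost in `n` (`(m, s) ↦ dc ≤ n^k + k`).  The known removal costs `(s+1)(m+1)^3`
  (`TransferToDc`, Hrubeš–Yehudayoff 2011 Thm. 4.2), i.e. quasi-polynomial here; the stub says the
  `s`-axis buys the permanent nothing at polynomial size ("no zeon-type compression of a
  polynomial-size determinant below dimension `2^n`").  It is implied by the piece (vacuity for
  large `n`) and, with `stub_vbpSlice`, implies it: a weakest-unknown-consequence cut (lens `wuc`),
  refutable by a `(poly, qp)`-representation of `per_n` with superpolynomial `dc` — the zeon and
  Glynn points (`s = 2^n`, `2^(n-1)`) lie outside its box.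
* `PolySizeQPAlgebra_of` — composition (proved): `n₀ := max`, modus ponens.
-/

noncomputable section

set_option linter.dupNamespace false

namespace Summit.ValiantsHypothesis.ValiantsHypothesis.Cruxes.PolySizeQPAlgebra.VbpSliceDealg

open MvPolynomial Matrix
open Literature.Computability.AlgebraicComplexity
open Summit.ValiantsHypothesis.ValiantsHypothesis.Theses.GrenetZeon

/-- **Stub 1 (`VNP ⊄ VBP`, dc form, for all large `n`).** For every `c` there is `n₀` with
`dc(per_n) > n^c + c` for all `n ≥ n₀`: the permanent has no polynomial-size affine determinantal
representations.  The `s = 1` slice of `PolySizeQPAlgebra` (`hasAlgDetRepr_one_iff`); the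
"for all large `n`" form of `per ∉ VBP` (Bürgisser 2000, Ch. 2; Malod–Portier 2008).  Open
(Mignon–Ressayre: `dc(per_n) ≥ n²/2` is the record), believed, strictly below `VP ≠ VNP` as far as
is known. Size: open-problem. -/
theorem stub_vbpSlice (c : ℕ) : ∃ n₀ : ℕ, ∀ n ≥ n₀, ¬ HasDetRepr (perPoly (Fin n) ℂ) (n ^ c + c) := by
  sorry

/-- **Stub 2 (de-algebraization at polynomial cost in the polynomial regime).** For every `c`
there are `k, n₀` such that for `n ≥ n₀`, an `(m, s)`-representation of `per_n` with `m ≤ n^c + c`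
and `s ≤ 2^((log₂ n + c)^c)` yields `dc(per_n) ≤ n^k + k`.  (General representations de-algebraize
at cost `(s+1)(m+1)^3` — `TransferToDc`; the stub asserts that for the permanent at polynomial size
the quasi-polynomial coefficient dimension is removable at polynomial cost.  Implied by
`PolySizeQPAlgebra`; the zeon/Glynn points are outside the box.) Conjecture-grade. Size: open. -/
theorem stub_dealgebraizePoly (c : ℕ) :
    ∃ k n₀ : ℕ, ∀ n ≥ n₀, ∀ m s : ℕ, m ≤ n ^ c + c → s ≤ 2 ^ ((Nat.log 2 n + c) ^ c) →
      HasAlgDetRepr (perPoly (Fin n) ℂ) m s → HasDetRepr (perPoly (Fin n) ℂ) (n ^ k + k) := by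
  sorry

/-- **Composition (proved): `PolySizeQPAlgebra` from the two stubs.** -/
theorem PolySizeQPAlgebra_of : PolySizeQPAlgebra := by
  intro c
  obtain ⟨k, n₁, h1⟩ := stub_dealgebraizePoly c
  obtain ⟨n₂, h2⟩ := stub_vbpSlice k
  refine ⟨max n₁ n₂, fun n hn m s hm hs hrep => ?_⟩
  exact h2 n (le_of_max_le_right hn) (h1 n (le_of_max_le_left hn) m s hm hs hrep)

/-! ### Special case (BC5): the slice stub at `c = 1` is Mignon–Ressayre -/

/-- `stub_vbpSlice` at `c = 1`, proved: `dc(per_n) ≥ n²/2 > n + 1` for `n ≥ 3`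
(`sq_le_two_mul_determinantalComplexity_perPoly_complex_holds`, Mignon–Ressayre 2004). -/
theorem vbpSlice_one : ∃ n₀ : ℕ, ∀ n ≥ n₀, ¬ HasDetRepr (perPoly (Fin n) ℂ) (n ^ 1 + 1) := by
  refine ⟨3, fun n hn h => ?_⟩
  have h1 : n ^ 2 ≤ 2 * determinantalComplexity (perPoly (Fin n) ℂ) :=
    sq_le_two_mul_determinantalComplexity_perPoly_complex_holds hn
  have h2 : determinantalComplexity (perPoly (Fin n) ℂ) ≤ n ^ 1 + 1 :=
    determinantalComplexity_le_of_hasDetRepr h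
  have h3 : n * n ≤ 2 * (n + 1) := by
    calc n * n = n ^ 2 := (sq n).symm
      _ ≤ 2 * (n ^ 1 + 1) := h1.trans (Nat.mul_le_mul_left 2 h2)
      _ = 2 * (n + 1) := by rw [pow_one]
  nlinarith

end Summit.ValiantsHypothesis.ValiantsHypothesis.Cruxes.PolySizeQPAlgebra.VbpSliceDealg
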